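import Literature.NumberTheory.Sieve.ShiuUniform
import Literature.NumberTheory.Sieve.DivisorBound
import Literature.NumberTheory.LFunctions.MertensElementary
import HarnessLib

/-!
# Shiu's theorem for the divisor class: `f(p) ≤ a + K log p + M/p`, `f(p^ν) ≤ C₅(ν+1)^d`

Topic `Literature/NumberTheory/Sieve`, companion of `ShiuUniform.lean` (Shiu's Brun–Titchmarsh
theorem for multiplicative functions, uniform in the function) and `RoughDivisorMoments.lean`.
Everything here is PROVED; no definition is introduced.

For non-negative `f` with `f(mn) = f(m)f(n)` for coprime `m, n`, the two hypotheses of Shiu's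
theorem — `f(p^l) ≤ A₁^l` and `f(n) ≤ A₂(δ)n^δ` — both follow from ONE prime-power bound of
divisor type, `f(p^ν) ≤ C₅(ν+1)^d` (`ν ≥ 1`): indeed `f(n) ≤ τ(n)^{c+d}` with `2^c ≥ max(C₅,1)`, and
`τ(n) ≪_δ n^δ` (Hardy–Wright Thm 315, the tree's `exists_sigma_zero_le_mul_rpow`). If moreover
`f(p) ≤ a + K log p + M/p` for the primes `p ≤ x`, Mertens' theorems in the tree's explicit form
(`MertensBound.sum_inv_prime_le`, `sum_log_div_prime_le`, `sum_inv_prime_mul_pred_le_one`) bound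
the Euler exponent `exp(∑_{p ≤ x} f(p)/p) ≤ e^{4a}(log x)^a · e^{K log(4x) + M}`. Hence:

* `shiu_divisor_class` — for `a d : ℕ`, `C₅ : ℝ` there are `C, x₀` (depending on `a, d, C₅` ONLY)
  such that for every such `f`, all `K, M ≥ 0`, `x ≥ x₀`, `x^{1/4} ≤ y ≤ x`:
  `∑_{x < n ≤ x+y} f(n) ≤ C · e^{K log(4x) + M} · y (log x)^a / log x`;
* `shiu_divisor_class_logMean`, `shiu_divisor_class_logMean_Ioc` — the logarithmic form
  `∑_{x < n ≤ x'} f(n)/n ≤ C e^{K log(4x)+M} ((x'−x)/x) (log x)^a/log x` for `x + x^{1/4} ≤ x' ≤ 2x`.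

The constants being independent of `f`, `K`, `M`, these apply uniformly to FAMILIES of majorants
whose prime values drift like `a + K_D log p` (e.g. coefficients of shifted zeta products
`ζ(s+β₁)ζ(s+β₂)ζ(s+β₃)/ζ(s)` with `|β_j| log x = O(1)`).

## References

* P. Shiu, *A Brun–Titchmarsh theorem for multiplicative functions*, J. reine angew. Math. 313
  (1980), 161–170, Theorem 1. [cite: Shiu1980, Theorem 1]
* G. H. Hardy, E. M. Wright, *An Introduction to the Theory of Numbers* (6th ed., OUP 2008),
  Thms 315, 425, 427. [cite: HardyWright2008, Theorems 315, 425, 427]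
-/

open Finset Real
open scoped ArithmeticFunction.sigma

namespace Literature.NumberTheory.Sieve

namespace ShiuDivisorClass

/-! ### From the divisor-type prime-power bound to Shiu's hypotheses -/

/-- A function multiplicative on coprime arguments has `f(1) = 1`, or vanishes identically.
[folklore] -/
private theorem map_one_eq_one_or_eq_zero {f : ℕ → ℝ}
    (hmul : ∀ m n : ℕ, m.Coprime n → f (m * n) = f m * f n) :
    f 1 = 1 ∨ ∀ n, f n = 0 := by
  have h1 : f 1 = f 1 * f 1 := by simpa using hmul 1 1 (Nat.coprime_one_left 1)
  by_cases h : f 1 = 1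
  · exact Or.inl h
  · right
    have h0 : f 1 = 0 := by
      have h2 : f 1 * (f 1 - 1) = 0 := by linear_combination (-1 : ℝ) * h1
      rcases mul_eq_zero.1 h2 with h3 | h3
      · exact h3
      · exact absurd (by linarith : f 1 = 1) h
    intro n
    have := hmul 1 n (Nat.coprime_one_left n)
    rw [one_mul, h0, zero_mul] at this
    exact this

/-- `C₅(ν+1)^d ≤ (max(C₅,1)·2^d)^ν` for `ν ≥ 1` (`ν + 1 ≤ 2^ν`). [folklore] -/
private theorem prime_pow_bound_le_pow {C₅ : ℝ} (d : ℕ) {ν : ℕ} (hν : 1 ≤ ν) :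
    C₅ * ((ν : ℝ) + 1) ^ d ≤ (max C₅ 1 * (2 : ℝ) ^ d) ^ ν := by
  have hA : 1 ≤ max C₅ 1 := le_max_right _ _
  have h1 : ((ν : ℝ) + 1) ≤ (2 : ℝ) ^ ν := by
    have := Nat.lt_two_pow_self (n := ν)
    exact_mod_cast this
  have h2 : ((ν : ℝ) + 1) ^ d ≤ ((2 : ℝ) ^ d) ^ ν := by
    calc ((ν : ℝ) + 1) ^ d ≤ ((2 : ℝ) ^ ν) ^ d := pow_le_pow_left₀ (by positivity) h1 d
      _ = ((2 : ℝ) ^ d) ^ ν := by rw [← pow_mul, ← pow_mul, mul_comm]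
  have h3 : C₅ ≤ (max C₅ 1) ^ ν :=
    le_trans (le_max_left _ _) (le_self_pow₀ hA (by omega))
  calc C₅ * ((ν : ℝ) + 1) ^ d ≤ (max C₅ 1) ^ ν * ((2 : ℝ) ^ d) ^ ν :=
        mul_le_mul h3 h2 (by positivity) (le_trans zero_le_one (one_le_pow₀ hA))
    _ = (max C₅ 1 * (2 : ℝ) ^ d) ^ ν := by rw [mul_pow]

/-- `f(n) ≤ τ(n)^{c+d}` whenever `f(1) = 1`, `f` is multiplicative on coprime arguments and
`f(p^ν) ≤ (ν+1)^{c+d}` at prime powers (`ν ≥ 1`). [folklore] -/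
private theorem le_card_divisors_pow {f : ℕ → ℝ} (hf1 : f 1 = 1) (hf0 : ∀ n, 0 ≤ f n)
    (hmul : ∀ m n : ℕ, m.Coprime n → f (m * n) = f m * f n) {e : ℕ}
    (hpow : ∀ p ν : ℕ, p.Prime → 1 ≤ ν → f (p ^ ν) ≤ ((ν : ℝ) + 1) ^ e) {n : ℕ} (hn : n ≠ 0) :
    f n ≤ ((σ 0 n : ℕ) : ℝ) ^ e := by
  rw [Nat.multiplicative_factorization f hmul hf1 hn, ArithmeticFunction.sigma_zero_apply,
    Nat.card_divisors hn, Finsupp.prod, Nat.support_factorization, Nat.cast_prod, ← prod_pow]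
  refine prod_le_prod (fun p _ => hf0 _) fun p hp => ?_
  have hp' : p.Prime := Nat.prime_of_mem_primeFactors hp
  have hk : 1 ≤ n.factorization p :=
    Nat.Prime.factorization_pos_of_dvd hp' hn (Nat.dvd_of_mem_primeFactors hp)
  have := hpow p (n.factorization p) hp' hk
  push_cast
  exact this

/-- **The divisor-bound majorant.** For `d : ℕ` and any real `C₅` there is `A₂ : ℝ → ℝ` such that EVERY
`f ≥ 0`, multiplicative on coprime arguments, with `f(p^ν) ≤ C₅(ν+1)^d` (`ν ≥ 1`) satisfies
`f(n) ≤ A₂(δ) n^δ` for all `δ > 0`, `n ≥ 1` (via `f ≤ τ^{c+d}`, `2^c ≥ max(C₅,1)`, and Hardy–Wright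
Thm 315). [cite: HardyWright2008, Theorem 315] -/
theorem exists_rpow_majorant (d : ℕ) (C₅ : ℝ) :
    ∃ A₂ : ℝ → ℝ, ∀ f : ℕ → ℝ, (∀ n, 0 ≤ f n) →
      (∀ m n : ℕ, m.Coprime n → f (m * n) = f m * f n) →
      (∀ p ν : ℕ, p.Prime → 1 ≤ ν → f (p ^ ν) ≤ C₅ * ((ν : ℝ) + 1) ^ d) →
      ∀ δ : ℝ, 0 < δ → ∀ n : ℕ, 1 ≤ n → f n ≤ A₂ δ * (n : ℝ) ^ δ := by
  classical
  -- an exponent `c ≥ 1` with `max(C₅,1) ≤ 2^c`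
  set c : ℕ := ⌈max C₅ 1⌉₊ with hc_def
  have hc1 : 1 ≤ c := by
    rw [hc_def]; exact Nat.one_le_ceil_iff.mpr (lt_of_lt_of_le zero_lt_one (le_max_right _ _))
  have hc2 : max C₅ 1 ≤ (2 : ℝ) ^ c := by
    have h1 : max C₅ 1 ≤ (c : ℝ) := Nat.le_ceil _
    have h2 : (c : ℝ) ≤ (2 : ℝ) ^ c := by exact_mod_cast (Nat.lt_two_pow_self (n := c)).le
    exact h1.trans h2
  set e : ℕ := c + d with he_def
  have he0 : 0 < e := by omega
  -- the divisor bound at exponent `δ/e`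
  have hch : ∀ δ : ℝ, 0 < δ → ∃ C : ℝ, 1 ≤ C ∧
      ∀ n : ℕ, ((σ 0 n : ℕ) : ℝ) ≤ C * (n : ℝ) ^ (δ / e) :=
    fun δ hδ => exists_sigma_zero_le_mul_rpow (by positivity)
  refine ⟨fun δ => if h : 0 < δ then (Classical.choose (hch δ h)) ^ e else 0, ?_⟩
  intro f hf0 hmul hpow δ hδ n hn
  dsimp only
  rw [dif_pos hδ]
  obtain ⟨hC1, hC⟩ := Classical.choose_spec (hch δ hδ)
  set C := Classical.choose (hch δ hδ) with hCdef
  have hn0 : n ≠ 0 := by omega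
  have hn0' : (0 : ℝ) < n := by exact_mod_cast hn
  rcases map_one_eq_one_or_eq_zero hmul with hf1 | hzero
  · -- `f ≤ τ^e ≤ (C n^{δ/e})^e = C^e n^δ`
    have hpow' : ∀ p ν : ℕ, p.Prime → 1 ≤ ν → f (p ^ ν) ≤ ((ν : ℝ) + 1) ^ e := by
      intro p ν hp hν
      have h2ν : (2 : ℝ) ≤ (ν : ℝ) + 1 := by
        have : (1 : ℝ) ≤ ν := by exact_mod_cast hν
        linarith
      calc f (p ^ ν) ≤ C₅ * ((ν : ℝ) + 1) ^ d := hpow p ν hp hν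
        _ ≤ (2 : ℝ) ^ c * ((ν : ℝ) + 1) ^ d :=
            mul_le_mul_of_nonneg_right ((le_max_left _ _).trans hc2) (by positivity)
        _ ≤ ((ν : ℝ) + 1) ^ c * ((ν : ℝ) + 1) ^ d :=
            mul_le_mul_of_nonneg_right (pow_le_pow_left₀ (by norm_num) h2ν c) (by positivity)
        _ = ((ν : ℝ) + 1) ^ e := by rw [he_def, pow_add]
    calc f n ≤ ((σ 0 n : ℕ) : ℝ) ^ e := le_card_divisors_pow hf1 hf0 hmul hpow' hn0
      _ ≤ (C * (n : ℝ) ^ (δ / e)) ^ e := pow_le_pow_left₀ (by positivity) (hC n) e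
      _ = C ^ e * ((n : ℝ) ^ (δ / e)) ^ e := mul_pow _ _ _
      _ = C ^ e * (n : ℝ) ^ δ := by
          rw [← Real.rpow_natCast ((n : ℝ) ^ (δ / e)) e, ← Real.rpow_mul hn0'.le,
            div_mul_cancel₀ δ (by exact_mod_cast he0.ne')]
  · rw [hzero n]; positivity

/-! ### The Euler exponent under `f(p) ≤ a + K log p + M/p` -/

/-- **The Euler exponent.** If `f ≥ 0` and `f(p) ≤ a + K log p + M/p` for the primes `p ≤ x`
(`K, M ≥ 0`, `x ≥ 2`), then
`∑_{p ≤ x, p ∤ 1} f(p)/p ≤ a(log log x + 4) + K(log x + log 4) + M` (Mertens, Hardy–Wright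
Thms 425, 427, in the tree's explicit form, and `∑_p 1/(p(p−1)) ≤ 1`).
[cite: HardyWright2008, Theorems 425, 427] -/
theorem euler_exponent_le {f : ℕ → ℝ} (hf0 : ∀ n, 0 ≤ f n) {a : ℕ} {K M : ℝ} (hK : 0 ≤ K)
    (hM : 0 ≤ M) {x : ℝ} (hx : 2 ≤ x)
    (hfp : ∀ p : ℕ, p.Prime → (p : ℝ) ≤ x → f p ≤ a + K * Real.log p + M / p) :
    ∑ p ∈ (Finset.Icc 1 ⌊x⌋₊).filter (fun p : ℕ => p.Prime ∧ ¬p ∣ 1), f p / p ≤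
      a * (Real.log (Real.log x) + 4) + K * (Real.log x + Real.log 4) + M := by
  set N : ℕ := ⌊x⌋₊ with hN
  have hx0 : 0 ≤ x := by linarith
  have hN2 : 2 ≤ N := by rw [hN]; exact Nat.le_floor (by exact_mod_cast hx)
  have hN0 : (0 : ℝ) < N := by exact_mod_cast (by omega : 0 < N)
  have hNx : (N : ℝ) ≤ x := Nat.floor_le hx0
  have hlogN : Real.log N ≤ Real.log x := Real.log_le_log hN0 hNx
  have hlogN0 : 0 < Real.log N :=
    Real.log_pos (by exact_mod_cast (by omega : 1 < N))
  have hloglogN : Real.log (Real.log N) ≤ Real.log (Real.log x) := Real.log_le_log hlogN0 hlogN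
  -- pass to the tree's `primesLE N`
  have hsub : (Finset.Icc 1 N).filter (fun p : ℕ => p.Prime ∧ ¬p ∣ 1) ⊆ Nat.primesLE N := by
    intro p hp
    simp only [Finset.mem_filter, Finset.mem_Icc] at hp
    exact Nat.mem_primesLE.mpr ⟨hp.1.2, hp.2.1⟩
  have h1 : ∑ p ∈ (Finset.Icc 1 N).filter (fun p : ℕ => p.Prime ∧ ¬p ∣ 1), f p / p ≤
      ∑ p ∈ Nat.primesLE N, f p / p :=
    Finset.sum_le_sum_of_subset_of_nonneg hsub fun p _ _ => div_nonneg (hf0 p) (Nat.cast_nonneg p)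
  -- termwise bound
  have h2 : ∀ p ∈ Nat.primesLE N, f p / p ≤
      a * ((1 : ℝ) / p) + K * (Real.log p / p) + M * ((1 : ℝ) / (p * (p - 1))) := by
    intro p hp
    obtain ⟨hpN, hpp⟩ := Nat.mem_primesLE.mp hp
    have hp2 : (2 : ℝ) ≤ p := by exact_mod_cast hpp.two_le
    have hp0 : (0 : ℝ) < p := by linarith
    have hpx : (p : ℝ) ≤ x := le_trans (by exact_mod_cast hpN) hNx
    have hf := hfp p hpp hpx
    have hMp : M / p / p ≤ M * (1 / (p * (p - 1))) := by
      rw [div_div, mul_one_div]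
      exact div_le_div_of_nonneg_left hM (by nlinarith) (by nlinarith)
    calc f p / p ≤ (a + K * Real.log p + M / p) / p := div_le_div_of_nonneg_right hf hp0.le
      _ = a * (1 / p) + K * (Real.log p / p) + M / p / p := by field_simp
      _ ≤ a * (1 / p) + K * (Real.log p / p) + M * (1 / (p * (p - 1))) := by linarith
  calc ∑ p ∈ (Finset.Icc 1 N).filter (fun p : ℕ => p.Prime ∧ ¬p ∣ 1), f p / p
      ≤ ∑ p ∈ Nat.primesLE N, f p / p := h1
    _ ≤ ∑ p ∈ Nat.primesLE N,
          (a * ((1 : ℝ) / p) + K * (Real.log p / p) + M * ((1 : ℝ) / (p * (p - 1)))) :=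
        Finset.sum_le_sum h2
    _ = a * ∑ p ∈ Nat.primesLE N, (1 : ℝ) / p + K * ∑ p ∈ Nat.primesLE N, Real.log p / p +
          M * ∑ p ∈ Nat.primesLE N, (1 : ℝ) / (p * (p - 1)) := by
        rw [Finset.sum_add_distrib, Finset.sum_add_distrib, Finset.mul_sum, Finset.mul_sum,
          Finset.mul_sum]
    _ ≤ a * (Real.log (Real.log N) + 4) + K * (Real.log N + Real.log 4) + M * 1 := by
        gcongr
        · exact Literature.NumberTheory.LFunctions.MertensBound.sum_inv_prime_le N hN2
        · exact Literature.NumberTheory.LFunctions.MertensBound.sum_log_div_prime_le N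
        · exact Literature.NumberTheory.LFunctions.MertensBound.sum_inv_prime_mul_pred_le_one N
    _ ≤ a * (Real.log (Real.log x) + 4) + K * (Real.log x + Real.log 4) + M := by
        have ha : (0 : ℝ) ≤ a := Nat.cast_nonneg a
        nlinarith [mul_le_mul_of_nonneg_left hloglogN ha, mul_le_mul_of_nonneg_left hlogN hK]

/-- The exponentiated form: `exp(∑_{p ≤ x, p ∤ 1} f(p)/p) ≤ e^{4a}(log x)^a · e^{K log(4x) + M}`
(`x ≥ 2`). [cite: HardyWright2008, Theorems 425, 427] -/
theorem exp_euler_exponent_le {f : ℕ → ℝ} (hf0 : ∀ n, 0 ≤ f n) {a : ℕ} {K M : ℝ} (hK : 0 ≤ K)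
    (hM : 0 ≤ M) {x : ℝ} (hx : 2 ≤ x)
    (hfp : ∀ p : ℕ, p.Prime → (p : ℝ) ≤ x → f p ≤ a + K * Real.log p + M / p) :
    Real.exp (∑ p ∈ (Finset.Icc 1 ⌊x⌋₊).filter (fun p : ℕ => p.Prime ∧ ¬p ∣ 1), f p / p) ≤
      Real.exp (4 * a) * Real.log x ^ a * Real.exp (K * Real.log (4 * x) + M) := by
  have hx0 : 0 < x := by linarith
  have hlog : 0 < Real.log x := Real.log_pos (by linarith)
  have h := euler_exponent_le hf0 hK hM hx hfp
  have h4x : Real.log (4 * x) = Real.log x + Real.log 4 := by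
    rw [Real.log_mul (by norm_num) hx0.ne']; ring
  calc Real.exp (∑ p ∈ (Finset.Icc 1 ⌊x⌋₊).filter (fun p : ℕ => p.Prime ∧ ¬p ∣ 1), f p / p)
      ≤ Real.exp (a * (Real.log (Real.log x) + 4) + K * (Real.log x + Real.log 4) + M) :=
        Real.exp_le_exp.mpr h
    _ = Real.exp (4 * a) * Real.log x ^ a * Real.exp (K * Real.log (4 * x) + M) := by
        rw [show (a : ℝ) * (Real.log (Real.log x) + 4) + K * (Real.log x + Real.log 4) + M =
            4 * a + a * Real.log (Real.log x) + (K * Real.log (4 * x) + M) by rw [h4x]; ring,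
          Real.exp_add, Real.exp_add, ← Real.log_rpow hlog, Real.exp_log (by positivity),
          Real.rpow_natCast]

/-! ### Shiu's theorem for the divisor class -/

/-- **Shiu's theorem for the divisor class** (Shiu 1980, Theorem 1, with `q = 1`; the constant
depends on `a, d, C₅` only). For `a d : ℕ` and a real `C₅` there are `C ≥ 0`, `x₀ ≥ 2` such that for
every `f ≥ 0` with `f(mn) = f(m)f(n)` (`(m,n) = 1`) and `f(p^ν) ≤ C₅(ν+1)^d` (`p` prime, `ν ≥ 1`),
all `K, M ≥ 0`, all `x ≥ x₀` and `x^{1/4} ≤ y ≤ x` such that `f(p) ≤ a + K log p + M/p` for the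
primes `p ≤ x`:
`∑_{x < n ≤ x+y} f(n) ≤ C · exp(K log(4x) + M) · y · (log x)^a / log x`.
[cite: Shiu1980, Theorem 1] -/
theorem shiu_divisor_class (a d : ℕ) (C₅ : ℝ) :
    ∃ C x₀ : ℝ, 0 ≤ C ∧ 2 ≤ x₀ ∧ ∀ f : ℕ → ℝ, (∀ n, 0 ≤ f n) →
      (∀ m n : ℕ, m.Coprime n → f (m * n) = f m * f n) →
      (∀ p ν : ℕ, p.Prime → 1 ≤ ν → f (p ^ ν) ≤ C₅ * ((ν : ℝ) + 1) ^ d) →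
      ∀ K M : ℝ, 0 ≤ K → 0 ≤ M → ∀ x y : ℝ, x₀ ≤ x → x ^ (1 / 4 : ℝ) ≤ y → y ≤ x →
        (∀ p : ℕ, p.Prime → (p : ℝ) ≤ x → f p ≤ a + K * Real.log p + M / p) →
        ∑ n ∈ (Finset.Icc 1 ⌊x + y⌋₊).filter (fun n : ℕ => x < n), f n ≤
          C * Real.exp (K * Real.log (4 * x) + M) * y * Real.log x ^ a / Real.log x := by
  obtain ⟨A₂, hA₂⟩ := exists_rpow_majorant d C₅
  obtain ⟨C, x₀, hC0, hS⟩ := shiu_uniform (A₁ := max C₅ 1 * (2 : ℝ) ^ d) (by positivity) A₂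
    (ε := 1 / 4) (θ := 1 / 4) (by norm_num) (by norm_num) (by norm_num) (by norm_num)
  refine ⟨C * Real.exp (4 * a), max x₀ 2, by positivity, le_max_right _ _, ?_⟩
  intro f hf0 hmul hpow K M hK hM x y hx hxy hyx hfp
  have hx2 : 2 ≤ x := le_trans (le_max_right _ _) hx
  have hx1 : 1 < x := by linarith
  have hlogx : 0 < Real.log x := Real.log_pos hx1
  have hpl : ∀ p l : ℕ, p.Prime → 1 ≤ l → f (p ^ l) ≤ (max C₅ 1 * (2 : ℝ) ^ d) ^ l :=
    fun p l hp hl => (hpow p l hp hl).trans (prime_pow_bound_le_pow d hl)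
  have hmaj : ∀ δ : ℝ, 0 < δ → ∀ n : ℕ, 1 ≤ n → f n ≤ A₂ δ * (n : ℝ) ^ δ :=
    fun δ hδ n hn => hA₂ f hf0 hmul hpow δ hδ n hn
  -- Shiu with `q = 1`, `a = 0`
  have hq : ((1 : ℕ) : ℝ) < y ^ (1 - 1 / 4 : ℝ) := by
    rw [Nat.cast_one]
    have hy1 : 1 < y := by
      have : (1 : ℝ) < x ^ (1 / 4 : ℝ) := Real.one_lt_rpow hx1 (by norm_num)
      linarith
    exact Real.one_lt_rpow hy1 (by norm_num)
  have h := hS f hf0 hmul hpl hmaj x y (le_trans (le_max_left _ _) hx) hxy hyx 1 le_rfl hq 0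
    (Nat.coprime_one_right 0)
  have hset : (Finset.Icc 1 ⌊x + y⌋₊).filter
      (fun n : ℕ => x < n ∧ (n : ZMod 1) = ((0 : ℕ) : ZMod 1)) =
      (Finset.Icc 1 ⌊x + y⌋₊).filter (fun n : ℕ => x < n) := by
    refine Finset.filter_congr fun n _ => ?_
    simp [Subsingleton.elim (n : ZMod 1) 0]
  rw [hset, Nat.totient_one, Nat.cast_one, one_mul] at h
  refine h.trans ?_
  have hy0 : 0 ≤ y := le_trans (Real.rpow_nonneg (by linarith) _) hxy
  have hexp := exp_euler_exponent_le hf0 hK hM hx2 hfp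
  calc C * y / Real.log x * Real.exp (∑ p ∈ (Finset.Icc 1 ⌊x⌋₊).filter
          (fun p : ℕ => p.Prime ∧ ¬p ∣ 1), f p / p)
      ≤ C * y / Real.log x *
          (Real.exp (4 * a) * Real.log x ^ a * Real.exp (K * Real.log (4 * x) + M)) :=
        mul_le_mul_of_nonneg_left hexp (by positivity)
    _ = C * Real.exp (4 * a) * Real.exp (K * Real.log (4 * x) + M) * y * Real.log x ^ a /
          Real.log x := by
        field_simp

/-- **Shiu's theorem for the divisor class, logarithmic short-interval mean**: with the same
`C, x₀` as in `shiu_divisor_class`, for `x ≥ x₀` and `x + x^{1/4} ≤ x' ≤ 2x`,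
`∑_{x < n ≤ x'} f(n)/n ≤ C · exp(K log(4x) + M) · ((x' − x)/x) · (log x)^a / log x`.
[cite: Shiu1980, Theorem 1] -/
theorem shiu_divisor_class_logMean (a d : ℕ) (C₅ : ℝ) :
    ∃ C x₀ : ℝ, 0 ≤ C ∧ 2 ≤ x₀ ∧ ∀ f : ℕ → ℝ, (∀ n, 0 ≤ f n) →
      (∀ m n : ℕ, m.Coprime n → f (m * n) = f m * f n) →
      (∀ p ν : ℕ, p.Prime → 1 ≤ ν → f (p ^ ν) ≤ C₅ * ((ν : ℝ) + 1) ^ d) →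
      ∀ K M : ℝ, 0 ≤ K → 0 ≤ M → ∀ x x' : ℝ, x₀ ≤ x → x + x ^ (1 / 4 : ℝ) ≤ x' → x' ≤ 2 * x →
        (∀ p : ℕ, p.Prime → (p : ℝ) ≤ x → f p ≤ a + K * Real.log p + M / p) →
        ∑ n ∈ (Finset.Icc 1 ⌊x'⌋₊).filter (fun n : ℕ => x < n), f n / n ≤
          C * Real.exp (K * Real.log (4 * x) + M) * ((x' - x) / x) * Real.log x ^ a /
            Real.log x := by
  obtain ⟨C, x₀, hC0, hx₀2, h⟩ := shiu_divisor_class a d C₅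
  refine ⟨C, x₀, hC0, hx₀2, ?_⟩
  intro f hf0 hmul hpow K M hK hM x x' hx hxx' hx'x hfp
  have hx2 : 2 ≤ x := le_trans hx₀2 hx
  have hx0 : 0 < x := by linarith
  have hlogx : 0 < Real.log x := Real.log_pos (by linarith)
  have key := h f hf0 hmul hpow K M hK hM x (x' - x) hx (by linarith) (by linarith) hfp
  rw [show x + (x' - x) = x' by ring] at key
  -- `f(n)/n ≤ f(n)/x` on the block
  have hterm : ∀ n ∈ (Finset.Icc 1 ⌊x'⌋₊).filter (fun n : ℕ => x < n), f n / n ≤ f n / x := by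
    intro n hn
    have hxn : x < n := (Finset.mem_filter.mp hn).2
    exact div_le_div_of_nonneg_left (hf0 n) hx0 hxn.le
  calc ∑ n ∈ (Finset.Icc 1 ⌊x'⌋₊).filter (fun n : ℕ => x < n), f n / n
      ≤ ∑ n ∈ (Finset.Icc 1 ⌊x'⌋₊).filter (fun n : ℕ => x < n), f n / x := Finset.sum_le_sum hterm
    _ = (∑ n ∈ (Finset.Icc 1 ⌊x'⌋₊).filter (fun n : ℕ => x < n), f n) / x := by
        rw [Finset.sum_div]
    _ ≤ (C * Real.exp (K * Real.log (4 * x) + M) * (x' - x) * Real.log x ^ a / Real.log x) / x :=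
        div_le_div_of_nonneg_right key hx0.le
    _ = C * Real.exp (K * Real.log (4 * x) + M) * ((x' - x) / x) * Real.log x ^ a /
          Real.log x := by
        field_simp

/-- The block `{n : x < n ≤ x'}` as `Finset.Ioc ⌊x⌋₊ ⌊x'⌋₊` (`x ≥ 0`). [folklore] -/
private theorem filter_Icc_eq_Ioc {x x' : ℝ} (hx : 0 ≤ x) :
    (Finset.Icc 1 ⌊x'⌋₊).filter (fun n : ℕ => x < n) = Finset.Ioc ⌊x⌋₊ ⌊x'⌋₊ := by
  ext n
  simp only [Finset.mem_filter, Finset.mem_Icc, Finset.mem_Ioc]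
  constructor
  · rintro ⟨⟨-, h2⟩, h3⟩
    exact ⟨(Nat.floor_lt hx).mpr h3, h2⟩
  · rintro ⟨h1, h2⟩
    exact ⟨⟨by omega, h2⟩, (Nat.floor_lt hx).mp h1⟩

/-- **Shiu's theorem for the divisor class, logarithmic mean over `Finset.Ioc ⌊x⌋₊ ⌊x'⌋₊`**
(same statement as `shiu_divisor_class_logMean`). [cite: Shiu1980, Theorem 1] -/
theorem shiu_divisor_class_logMean_Ioc (a d : ℕ) (C₅ : ℝ) :
    ∃ C x₀ : ℝ, 0 ≤ C ∧ 2 ≤ x₀ ∧ ∀ f : ℕ → ℝ, (∀ n, 0 ≤ f n) →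
      (∀ m n : ℕ, m.Coprime n → f (m * n) = f m * f n) →
      (∀ p ν : ℕ, p.Prime → 1 ≤ ν → f (p ^ ν) ≤ C₅ * ((ν : ℝ) + 1) ^ d) →
      ∀ K M : ℝ, 0 ≤ K → 0 ≤ M → ∀ x x' : ℝ, x₀ ≤ x → x + x ^ (1 / 4 : ℝ) ≤ x' → x' ≤ 2 * x →
        (∀ p : ℕ, p.Prime → (p : ℝ) ≤ x → f p ≤ a + K * Real.log p + M / p) →
        ∑ n ∈ Finset.Ioc ⌊x⌋₊ ⌊x'⌋₊, f n / n ≤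
          C * Real.exp (K * Real.log (4 * x) + M) * ((x' - x) / x) * Real.log x ^ a /
            Real.log x := by
  obtain ⟨C, x₀, hC0, hx₀2, h⟩ := shiu_divisor_class_logMean a d C₅
  refine ⟨C, x₀, hC0, hx₀2, ?_⟩
  intro f hf0 hmul hpow K M hK hM x x' hx hxx' hx'x hfp
  rw [← filter_Icc_eq_Ioc (by linarith : (0 : ℝ) ≤ x)]
  exact h f hf0 hmul hpow K M hK hM x x' hx hxx' hx'x hfp

end ShiuDivisorClass

end Literature.NumberTheory.Sieve
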